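import Mathlib
import Literature.Analysis.ODE.GaussianBeamPhase1D
import Literature.Analysis.PDE.GaussianBeam1DEnergy
import Literature.Analysis.PDE.GaussianBeam1DData
import Literature.Geometry.Lorentzian.ReggeWheelerChannels
import Summits.FinalStateConjecture.FinalStateConjecture.Theorems.PhotonSphereChannelsCauchyWaveGlobal
import Summits.FinalStateConjecture.FinalStateConjecture.Theorems.PhotonSphereChannelsWindowedShellChannelsLagLawPacket
import Summits.FinalStateConjecture.FinalStateConjecture.Theorems.PhotonSphereChannelsWindowedShellChannelsLagLawBeam

/-!
# `WindowedShellChannels` (stmt-FinalStateConjecture-14085), the lag laws — V: the beam package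
# uniform in the horizon, and the packet contradiction

Support file (prover seat 1; everything proved, no definitions). Two reusable pieces of the lag
laws for the crux `WindowedShellChannels`:

* `beam_package_uniform` — the cut rest-beam package of `LagLaw.beam_package`
  (`…LagLawBeam.lean`) with the quantifiers in the order `∃ X ξ, … ∧ ∀ T, ∃ B, ∀ μ, ∃ G_μ, …`:
  the centre and the phases of the beam do not depend on the horizon `T` (only the residual
  constant `B` does), so `T` may be chosen by looking at the trajectory `X` — as the near-side
  law must (the infall time to a prescribed lag is read off the ray);
* `packet_contradiction` — the common final step: the body `Inner(ρ, h, c)` of the crux for the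
  potentials `ℓ(ℓ+1)q`, a beam family whose datum is supported off the shell `{|x| ≤ ρ}` and whose
  slab at time `T` lies inside the lagged ball `{|x| ≤ ρ − h + T}` are contradictory
  (`LagLaw.stub_lagLawPacket`: both channels `≤ 2(e−1)T²·2δ₀B²μ`; energy `≥ 2e^{−1}q₀μ^{3/2}`;
  `ℓ → ∞`).

[cite: Ralston1982, §2; Sbierski2015, §3]
-/

noncomputable section

-- every `Summit.FinalStateConjecture.FinalStateConjecture.…` name repeats the summit = sub-problem
-- segment (D-0017 layout), as in every landed `…Theorems` file of this route
set_option linter.dupNamespace false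

namespace Summit.FinalStateConjecture.FinalStateConjecture.Theorems.LagLaw

open Literature.Geometry.Lorentzian Literature.Geometry.Lorentzian.ReggeWheeler
open Literature.Analysis.ODE Literature.Analysis.PDE
open Summit.FinalStateConjecture.FinalStateConjecture.Theorems
open MeasureTheory Set Filter Topology Function Complex
open scoped ENNReal NNReal

/-! ### The beam package, uniform in the horizon -/

/-- **The cut rest-beam package, uniform in the horizon.** Same as `beam_package`, but the centre
`X` is produced BEFORE the horizon `T` is chosen (`∀ T, ∃ B, …`): the phases of
`Literature.Analysis.ODE.exists_beamPhase` do not depend on `T`, only the residual constant does.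
This is the form needed when `T` is read off the trajectory itself (near-side law). -/
theorem beam_package_uniform {q : ℝ → ℝ} (hq : ContDiff ℝ 3 q) {K : ℝ≥0}
    (hK : LipschitzWith K (deriv q)) (hqpos : ∀ x, 0 < q x) (X₀ : ℝ) {δ₀ : ℝ} (hδ₀ : 0 < δ₀) :
    ∃ (X ξ : ℝ → ℝ), X 0 = X₀ ∧ ξ 0 = 0 ∧ ContDiff ℝ 2 X ∧
      (∀ t, HasDerivAt X (ξ t / Real.sqrt (q X₀)) t) ∧
      (∀ t, HasDerivAt ξ (-(deriv q (X t)) / (2 * Real.sqrt (q X₀))) t) ∧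
      (∀ t, |X t - X 0| ≤ |t|) ∧
      ∀ T : ℝ, ∃ B : ℝ, 0 ≤ B ∧ ∀ μ : ℝ, 1 ≤ μ → 4 / δ₀ ^ 2 ≤ μ →
        ∃ G : ℝ → ℝ → ℝ, ContDiff ℝ 2 (uncurry G) ∧
          (∀ t x, δ₀ ≤ |x - X t| → G t x = 0) ∧
          (∀ x, deriv (fun τ => G τ x) 0 = 0) ∧
          (∀ t ∈ Icc 0 T, ∫ x, (iteratedDeriv 2 (fun τ => G τ x) t - iteratedDeriv 2 (G t) x
              + μ ^ 2 * q x * G t x) ^ 2 ≤ 2 * δ₀ * (B ^ 2 * μ)) ∧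
          (∀ q₀ : ℝ, 0 ≤ q₀ → (∀ x ∈ Icc (X₀ - δ₀) (X₀ + δ₀), q₀ ≤ q x) →
              ENNReal.ofReal (μ ^ 2 * q₀ * Real.exp (-1) * (2 / Real.sqrt μ))
                ≤ ∫⁻ x, ENNReal.ofReal (μ ^ 2 * q x * G 0 x ^ 2)) := by
  obtain ⟨X, ξ, θ, Γ, a, hX0, hξ0, hθ0, hΓ0, ha0, hX2, hξ2, hθ2, hΓ2, ha2, hdX, hdξ, hcons, hdθ,
    hdΓ, hIm, hda, hdX0, hda0, hdΓ0⟩ := exists_beamPhase hq hK (hqpos X₀) one_pos (1 : ℂ)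
  have hω₀ : 0 < Real.sqrt (q X₀) := Real.sqrt_pos.2 (hqpos X₀)
  have hXd : Differentiable ℝ X := hX2.differentiable two_ne_zero
  have hξd : Differentiable ℝ ξ := hξ2.differentiable two_ne_zero
  have hXH : ∀ t, HasDerivAt X (ξ t / Real.sqrt (q X₀)) t := fun t => by
    have h := (hXd t).hasDerivAt; rwa [hdX t] at h
  have hξH : ∀ t, HasDerivAt ξ (-(deriv q (X t)) / (2 * Real.sqrt (q X₀))) t := fun t => by
    have h := (hξd t).hasDerivAt; rwa [hdξ t] at h
  -- `|X′| ≤ 1`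
  have hX1 : ∀ t, |deriv X t| ≤ 1 := by
    intro t
    rw [hdX t, abs_div, abs_of_pos hω₀, div_le_one hω₀]
    have h1 : ξ t ^ 2 ≤ Real.sqrt (q X₀) ^ 2 := by linarith [hcons t, hqpos (X t)]
    have h2 := sq_le_sq.1 h1
    rwa [abs_of_pos hω₀] at h2
  have hXlip : ∀ t, |X t - X 0| ≤ |t| := by
    intro t
    have h := Convex.norm_image_sub_le_of_norm_deriv_le (f := X) (C := 1) (s := univ)
      (fun x _ => hXd x) (fun x _ => by rw [Real.norm_eq_abs]; exact hX1 x) convex_univ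
      (mem_univ 0) (mem_univ t)
    rw [Real.norm_eq_abs, Real.norm_eq_abs, sub_zero, one_mul] at h
    exact h
  refine ⟨X, ξ, hX0, hξ0, hX2, hXH, hξH, hXlip, fun T => ?_⟩
  -- the cut-off
  let f : ContDiffBump (0 : ℝ) := ⟨δ₀ / 2, δ₀, by positivity, by linarith⟩
  have hχ : ContDiff ℝ 2 (f : ℝ → ℝ) := f.contDiff
  have hχ1 : ∀ y ∈ Icc (-(δ₀ / 2)) (δ₀ / 2), f y = 1 := fun y hy =>
    f.one_of_mem_closedBall (by
      rw [Metric.mem_closedBall, dist_zero_right, Real.norm_eq_abs]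
      exact abs_le.2 ⟨hy.1, hy.2⟩)
  have hχ0 : ∀ y, δ₀ ≤ |y| → f y = 0 := fun y hy =>
    f.zero_of_le_dist (by rw [dist_zero_right, Real.norm_eq_abs]; exact hy)
  -- the residual constant (uniform in `μ ≥ 1`)
  obtain ⟨B, hB0, hB⟩ := cutBeam_residual_pointwise hq hω₀.ne' hX2 hξ2 hθ2 hΓ2 ha2 hdX hdξ hcons
    hdθ hdΓ hda hIm hX1 hχ hδ₀ hχ1 hχ0 T
  refine ⟨B, hB0, fun μ hμ1 hμ4 => ?_⟩
  have hμ0 : 0 < μ := by linarith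
  refine ⟨fun t x => f (x - X t) * (a t * cexp (I * μ * ((θ t : ℂ) + (ξ t : ℂ) * ((x : ℂ) - X t)
    + Γ t / 2 * ((x : ℂ) - X t) ^ 2))).re, ?_, ?_, ?_, ?_, ?_⟩
  · -- jointly `C²`
    have h1 : ContDiff ℝ 2 fun p : ℝ × ℝ => f (p.2 - X p.1) :=
      hχ.comp (contDiff_snd.sub (hX2.comp contDiff_fst))
    have h2 := Complex.reCLM.contDiff.comp (contDiff_beam (μ := μ) hX2 hξ2 hθ2 hΓ2 ha2)
    exact h1.mul h2
  · -- support in the slab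
    intro t x hx
    exact cutBeam_eq_zero_of_le hχ0 hx
  · -- rest datum: `∂_t G(0, ·) = 0`
    intro x
    have ha0im : (a 0).im = 0 := by rw [ha0]; simp
    have hda0re : (deriv a 0).re = 0 := by
      have h : deriv a 0 = ((-(1 / (2 * Real.sqrt (q X₀))) : ℝ) : ℂ) * I := by
        rw [hda0]; push_cast; ring
      rw [h, Complex.re_ofReal_mul, Complex.I_re, mul_zero]
    exact cutBeam_initial_deriv hχ hX2 hξ2 hθ2 hΓ2 ha2 hξ0 hθ0 hΓ0 ha0im hdX0 hda0re hdΓ0 x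
  · -- residual bound on `[0, T]`
    intro t ht
    refine integral_sq_le_of_bound (c := X t) hμ0.le hδ₀.le (fun x => ?_) (fun x hx => ?_)
    · have h := hB μ hμ1 t ht x
      exact h
    · -- off the slab the cut beam vanishes near `(t, x)`, so its residual vanishes
      have hopen : IsOpen {p : ℝ × ℝ | δ₀ < |p.2 - X p.1|} :=
        isOpen_lt continuous_const ((continuous_snd.sub (hX2.continuous.comp continuous_fst)).abs)
      have hG0 : ∀ p : ℝ × ℝ, δ₀ < |p.2 - X p.1| →
          f (p.2 - X p.1) * (a p.1 * cexp (I * μ * ((θ p.1 : ℂ) + (ξ p.1 : ℂ) * ((p.2 : ℂ) - X p.1)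
            + Γ p.1 / 2 * ((p.2 : ℂ) - X p.1) ^ 2))).re = 0 := fun p hp =>
        cutBeam_eq_zero_of_le hχ0 hp.le
      have ht' : (fun τ => f (x - X τ) * (a τ * cexp (I * μ * ((θ τ : ℂ) + (ξ τ : ℂ) * ((x : ℂ) - X τ)
          + Γ τ / 2 * ((x : ℂ) - X τ) ^ 2))).re) =ᶠ[𝓝 t] fun _ => 0 := by
        have hc : Continuous fun τ : ℝ => (τ, x) := Continuous.prodMk_left x
        have hmem : {p : ℝ × ℝ | δ₀ < |p.2 - X p.1|} ∈ 𝓝 (t, x) := hopen.mem_nhds hx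
        filter_upwards [hc.continuousAt.preimage_mem_nhds hmem] with τ hτ
        exact hG0 (τ, x) hτ
      have hx' : (fun y => f (y - X t) * (a t * cexp (I * μ * ((θ t : ℂ) + (ξ t : ℂ) * ((y : ℂ) - X t)
          + Γ t / 2 * ((y : ℂ) - X t) ^ 2))).re) =ᶠ[𝓝 x] fun _ => 0 := by
        have hc : Continuous fun y : ℝ => (t, y) := Continuous.prodMk_right t
        have hmem : {p : ℝ × ℝ | δ₀ < |p.2 - X p.1|} ∈ 𝓝 (t, x) := hopen.mem_nhds hx
        filter_upwards [hc.continuousAt.preimage_mem_nhds hmem] with y hy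
        exact hG0 (t, y) hy
      obtain ⟨h0, -, h2t⟩ := derivs_eq_zero_of_eventuallyEq_zero ht'
      obtain ⟨-, -, h2x⟩ := derivs_eq_zero_of_eventuallyEq_zero hx'
      simp only
      rw [h2t, h2x, h0, mul_zero, sub_zero, add_zero]
  · -- potential energy of the Gaussian datum
    intro q₀ hq₀ hqI
    have hinit : ∀ x, f (x - X 0) * (a 0 * cexp (I * μ * ((θ 0 : ℂ) + (ξ 0 : ℂ) * ((x : ℂ) - X 0)
        + Γ 0 / 2 * ((x : ℂ) - X 0) ^ 2))).re
        = f (x - X₀) * 1 * Real.exp (-(μ * 1 * (x - X₀) ^ 2 / 2)) := by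
      intro x
      rw [cutBeam_initial (μ := μ) (β₀ := 1) hX0 hξ0 hθ0 hΓ0 x, ha0, Complex.one_re]
    have hμ4' : 4 / (1 * δ₀ ^ 2) ≤ μ := by rwa [one_mul]
    have hS : ∀ x ∈ Icc (X₀ - 1 / Real.sqrt (μ * 1)) (X₀ + 1 / Real.sqrt (μ * 1)),
        μ ^ 2 * q₀ * Real.exp (-1) ≤ μ ^ 2 * q x
          * (f (x - X 0) * (a 0 * cexp (I * μ * ((θ 0 : ℂ) + (ξ 0 : ℂ) * ((x : ℂ) - X 0)
            + Γ 0 / 2 * ((x : ℂ) - X 0) ^ 2))).re) ^ 2 := by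
      intro x hx
      rw [hinit x]
      have h := cutBeam_initial_potential_ge (χ := f) (q := q) (X₀ := X₀) (a₀ := 1) one_pos hδ₀
        hμ4' hq₀ hχ1 hqI hx
      simpa only [one_pow, mul_one] using h
    have hlow := lintegral_ofReal_ge_of_le_on_Icc (by positivity) hS
    have hwidth : X₀ + 1 / Real.sqrt (μ * 1) - (X₀ - 1 / Real.sqrt (μ * 1)) = 2 / Real.sqrt μ := by
      rw [mul_one]; ring
    rw [hwidth] at hlow
    exact hlow


/-! ### The packet contradiction -/

/-- **The packet contradiction.** Abstract form of the last step of both lag laws: if the body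
`Inner` of the crux holds at `(ρ, h, c)` for the potentials `ℓ(ℓ+1)q` (`ℓ ≥ 1`, centre `0`), then
NO cut rest-beam family (`beam_package`/`beam_package_uniform` output: centre `X`, one residual
constant `B` on `[0, T]` for all frequencies) can have its datum supported off the shell
(`hslab`) and its slab at time `T` inside the lagged ball (`hball`, with `0 ≤ ρ − h + T`): the two
channels of the true solution with the beam's data are `O(μ)` (`stub_lagLawPacket`) while its
energy is `≳ μ^{3/2}`. -/
theorem packet_contradiction {q : ℝ → ℝ} {Cq : ℝ} (hq : ∀ n : ℕ∞, ContDiff ℝ n q)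
    (hqpos : ∀ x, 0 < q x) (hqb : ∀ x, |q x| ≤ Cq)
    {ρ h c δ₀ T X₀ B : ℝ} {X : ℝ → ℝ} (hc : 0 < c) (hδ₀ : 0 < δ₀) (hT : 0 < T)
    (ha : 0 ≤ ρ - h + T) (hX0 : X 0 = X₀) (hXc : Continuous X) (hXlip : ∀ t, |X t - X 0| ≤ |t|)
    (hBμ : ∀ μ : ℝ, 1 ≤ μ → 4 / δ₀ ^ 2 ≤ μ →
        ∃ G : ℝ → ℝ → ℝ, ContDiff ℝ 2 (uncurry G) ∧
          (∀ t x, δ₀ ≤ |x - X t| → G t x = 0) ∧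
          (∀ x, deriv (fun τ => G τ x) 0 = 0) ∧
          (∀ t ∈ Icc 0 T, ∫ x, (iteratedDeriv 2 (fun τ => G τ x) t - iteratedDeriv 2 (G t) x
              + μ ^ 2 * q x * G t x) ^ 2 ≤ 2 * δ₀ * (B ^ 2 * μ)) ∧
          (∀ q₀ : ℝ, 0 ≤ q₀ → (∀ x ∈ Icc (X₀ - δ₀) (X₀ + δ₀), q₀ ≤ q x) →
              ENNReal.ofReal (μ ^ 2 * q₀ * Real.exp (-1) * (2 / Real.sqrt μ))
                ≤ ∫⁻ x, ENNReal.ofReal (μ ^ 2 * q x * G 0 x ^ 2)))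
    (hslab : ∀ x, |x| ≤ ρ → δ₀ ≤ |x - X₀|)
    (hball : ∀ x, ρ - h + |T| < |x - 0| → δ₀ < |x - X T|)
    (hInner : ∀ ℓ : ℕ, 1 ≤ ℓ → ∀ ψ : ℝ → ℝ → ℝ,
        IsSolution (fun x => ((ℓ : ℝ) * ((ℓ : ℝ) + 1)) * q x) ψ →
        CauchyDataSupportedOn ψ {x : ℝ | ρ < |x - 0|} →
        ENNReal.ofReal c * totalEnergy (fun x => ((ℓ : ℝ) * ((ℓ : ℝ) + 1)) * q x) ψ 0
          ≤ channelEnergy (fun x => ((ℓ : ℝ) * ((ℓ : ℝ) + 1)) * q x) 0 (ρ - h) ψ atTop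
            + channelEnergy (fun x => ((ℓ : ℝ) * ((ℓ : ℝ) + 1)) * q x) 0 (ρ - h) ψ atBot) :
    False := by
  have hcq : Continuous q := (hq 0).continuous
  /- (1) a positive lower bound `q₀` of `q` on the datum's slab, and the frequency -/
  obtain ⟨q₀, hq₀, hq₀'⟩ := Literature.Analysis.PDE.exists_pos_le_of_continuous_Icc hcq hqpos
    (X₀ - δ₀) (X₀ + δ₀)
  obtain ⟨C₁, hC₁⟩ : ∃ C₁ : ℝ, C₁ = (Real.exp 1 - 1) * T ^ 2 * (2 * δ₀ * B ^ 2) := ⟨_, rfl⟩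
  obtain ⟨C₂, hC₂⟩ : ∃ C₂ : ℝ, C₂ = q₀ * Real.exp (-1) * 2 := ⟨_, rfl⟩
  have he1 : 0 ≤ Real.exp 1 - 1 := by linarith [Real.add_one_le_exp (1 : ℝ)]
  have hC₁0 : 0 ≤ C₁ := by rw [hC₁]; positivity
  have hC₂0 : 0 < C₂ := by rw [hC₂]; positivity
  obtain ⟨A₀, hA₀⟩ : ∃ A₀ : ℝ, A₀ = 2 * C₁ / (c * C₂) := ⟨_, rfl⟩
  have hA₀0 : 0 ≤ A₀ := by rw [hA₀]; positivity
  obtain ⟨ℓ, hℓ⟩ : ∃ ℓ : ℕ, ℓ = ⌈max (4 / δ₀ ^ 2) (A₀ ^ 2)⌉₊ + 1 := ⟨_, rfl⟩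
  have hℓ1 : 1 ≤ ℓ := by rw [hℓ]; exact Nat.le_add_left 1 _
  have hℓR : max (4 / δ₀ ^ 2) (A₀ ^ 2) + 1 ≤ (ℓ : ℝ) := by
    rw [hℓ]; push_cast
    linarith [Nat.le_ceil (max (4 / δ₀ ^ 2) (A₀ ^ 2))]
  have hℓpos : (0 : ℝ) < ℓ := by exact_mod_cast hℓ1
  obtain ⟨μ, hμ⟩ : ∃ μ : ℝ, μ = Real.sqrt ((ℓ : ℝ) * ((ℓ : ℝ) + 1)) := ⟨_, rfl⟩
  have hμsq : μ ^ 2 = (ℓ : ℝ) * ((ℓ : ℝ) + 1) := by rw [hμ, Real.sq_sqrt (by positivity)]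
  have hμℓ : (ℓ : ℝ) ≤ μ := by
    rw [hμ]
    calc (ℓ : ℝ) = Real.sqrt ((ℓ : ℝ) ^ 2) := (Real.sqrt_sq hℓpos.le).symm
      _ ≤ Real.sqrt ((ℓ : ℝ) * ((ℓ : ℝ) + 1)) := Real.sqrt_le_sqrt (by nlinarith)
  have hμ1 : 1 ≤ μ := le_trans (by exact_mod_cast hℓ1) hμℓ
  have hμ0 : 0 < μ := by linarith
  have hμ4 : 4 / δ₀ ^ 2 ≤ μ := by linarith [le_max_left (4 / δ₀ ^ 2) (A₀ ^ 2)]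
  have hμA : A₀ < Real.sqrt μ := by
    have h1 : A₀ ^ 2 < μ := by linarith [le_max_right (4 / δ₀ ^ 2) (A₀ ^ 2)]
    calc A₀ = Real.sqrt (A₀ ^ 2) := (Real.sqrt_sq hA₀0).symm
      _ < Real.sqrt μ := Real.sqrt_lt_sqrt (sq_nonneg _) h1
  /- (2) the cut beam `G`, the true solution `ψ` with its data -/
  obtain ⟨G, hGC, hG0, hGt0, hres, hlowG⟩ := hBμ μ hμ1 hμ4
  have hVeq : (fun x => ((ℓ : ℝ) * ((ℓ : ℝ) + 1)) * q x) = fun x => μ ^ 2 * q x := by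
    funext x; rw [hμsq]
  have hV1 : ContDiff ℝ 1 fun x => μ ^ 2 * q x := contDiff_const.mul (hq 1)
  have hV0 : ∀ x, 0 ≤ μ ^ 2 * q x := fun x => by positivity [hqpos x]
  have hVb : ∀ x, |μ ^ 2 * q x| ≤ μ ^ 2 * Cq := fun x => by
    rw [abs_mul, abs_of_nonneg (sq_nonneg μ)]
    exact mul_le_mul_of_nonneg_left (hqb x) (sq_nonneg μ)
  have hA : ContDiff ℝ 2 (G 0) := hGC.comp (contDiff_const.prodMk contDiff_id)
  obtain ⟨ψ, hψC, hψeq, hψ0, hψ1⟩ := CauchyWaveGlobal.exists_solution_global hV1 hVb hV0 hA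
    (contDiff_const (c := (0 : ℝ)))
  have hψsol : IsSolution (fun x => μ ^ 2 * q x) ψ := ⟨hψC, fun z => hψeq z.1 z.2⟩
  have hψ1' : ∀ x, deriv (fun τ => ψ τ x) 0 = 0 := fun x => hψ1 x
  have hdata : CauchyDataSupportedOn ψ {x : ℝ | ρ < |x - 0|} := by
    intro x hx
    simp only [mem_setOf_eq, not_lt, sub_zero] at hx
    refine ⟨?_, hψ1' x⟩
    rw [hψ0]
    apply hG0
    rw [hX0]
    exact hslab x hx
  -- the purported witness, at level `ℓ`, for `ψ`
  have hI := hInner ℓ hℓ1 ψ (by rw [hVeq]; exact hψsol) hdata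
  rw [hVeq] at hI
  /- (3) upper bound of the two channels, lower bound of the energy -/
  have hres' : ∀ t ∈ Icc 0 T, ∫ x, (iteratedDeriv 2 (fun τ => G τ x) t - iteratedDeriv 2 (G t) x
      + (fun x => μ ^ 2 * q x) x * G t x) ^ 2 ≤ 2 * δ₀ * (B ^ 2 * μ) := hres
  have hN2 : 0 ≤ 2 * δ₀ * (B ^ 2 * μ) := by positivity
  have hup := channelEnergy_add_le_of_beam hV1 hV0 hGC hXc hXlip hG0 hGt0 hδ₀ hT hN2
    hres' hψsol hψ0 hψ1' ha hball
  have hpot : ∫⁻ x, ENNReal.ofReal ((fun x => μ ^ 2 * q x) x * ψ 0 x ^ 2)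
      ≤ totalEnergy (fun x => μ ^ 2 * q x) ψ 0 := by
    unfold totalEnergy energyDensity
    refine lintegral_mono fun x => ENNReal.ofReal_le_ofReal ?_
    nlinarith [sq_nonneg (deriv (fun τ => ψ τ x) 0), sq_nonneg (deriv (ψ 0) x)]
  have hlow : ENNReal.ofReal (μ ^ 2 * q₀ * Real.exp (-1) * (2 / Real.sqrt μ))
      ≤ totalEnergy (fun x => μ ^ 2 * q x) ψ 0 := by
    refine (hlowG q₀ hq₀.le hq₀').trans (le_trans (le_of_eq ?_) hpot)
    refine lintegral_congr fun x => ?_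
    rw [hψ0]
  /- (4) `c · E_low ≤ 2 · E_err`, contradicting the choice of `ℓ` -/
  have hfin : ENNReal.ofReal (c * (μ ^ 2 * q₀ * Real.exp (-1) * (2 / Real.sqrt μ)))
      ≤ ENNReal.ofReal (2 * ((Real.exp 1 - 1) * T ^ 2 * (2 * δ₀ * (B ^ 2 * μ)))) := by
    rw [ENNReal.ofReal_mul hc.le, ENNReal.ofReal_mul (by norm_num : (0 : ℝ) ≤ 2),
      ENNReal.ofReal_ofNat]
    exact (mul_le_mul' le_rfl hlow).trans (hI.trans hup)
  have hreal := (ENNReal.ofReal_le_ofReal_iff (by positivity)).1 hfin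
  obtain ⟨s, hs⟩ : ∃ s : ℝ, s = Real.sqrt μ := ⟨_, rfl⟩
  have hs0 : 0 < s := by rw [hs]; exact Real.sqrt_pos.2 hμ0
  have hμs : μ = s ^ 2 := by rw [hs, Real.sq_sqrt hμ0.le]
  have hkey : 2 * C₁ < s * (c * C₂) := by
    have h1 := hμA
    rw [← hs, hA₀, div_lt_iff₀ (by positivity)] at h1
    linarith
  have eL : c * (μ ^ 2 * q₀ * Real.exp (-1) * (2 / Real.sqrt μ)) = s ^ 2 * (s * (c * C₂)) := by
    rw [← hs, hμs, hC₂]; field_simp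
  have eR : 2 * ((Real.exp 1 - 1) * T ^ 2 * (2 * δ₀ * (B ^ 2 * s ^ 2))) = s ^ 2 * (2 * C₁) := by
    rw [hC₁]; ring
  rw [eL, hμs, eR] at hreal
  exact absurd (mul_lt_mul_of_pos_left hkey (pow_pos hs0 2)) (not_lt.2 hreal)

/-- **Registered sub-goal `stub_lagLawUniformBeam` of stmt-FinalStateConjecture-14085** (seat 1, lag
laws): the cut rest-beam package uniform in the horizon, with explicit binders. -/
theorem stub_lagLawUniformBeam : ∀ (q : ℝ → ℝ) (K : NNReal) (X₀ δ₀ : ℝ), ContDiff ℝ 3 q → LipschitzWith K (deriv q) → (∀ x, 0 < q x) → 0 < δ₀ → ∃ (X ξ : ℝ → ℝ), X 0 = X₀ ∧ ξ 0 = 0 ∧ ContDiff ℝ 2 X ∧ (∀ t, HasDerivAt X (ξ t / Real.sqrt (q X₀)) t) ∧ (∀ t, HasDerivAt ξ (-(deriv q (X t)) / (2 * Real.sqrt (q X₀))) t) ∧ (∀ t, |X t - X 0| ≤ |t|) ∧ ∀ T : ℝ, ∃ B : ℝ, 0 ≤ B ∧ ∀ μ : ℝ, 1 ≤ μ → 4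 / δ₀ ^ 2 ≤ μ → ∃ G : ℝ → ℝ → ℝ, ContDiff ℝ 2 (Function.uncurry G) ∧ (∀ t x, δ₀ ≤ |x - X t| → G t x = 0) ∧ (∀ x, deriv (fun τ => G τ x) 0 = 0) ∧ (∀ t ∈ Set.Icc 0 T, ∫ x, (iteratedDeriv 2 (fun τ => G τ x) t - iteratedDeriv 2 (G t) x + μ ^ 2 * q x * G t x) ^ 2 ≤ 2 * δ₀ * (B ^ 2 * μ)) ∧ ∀ q₀ : ℝ, 0 ≤ q₀ → (∀ x ∈ Set.Icc (X₀ - δ₀) (X₀ + δ₀), q₀ ≤ q x) → ENNReal.ofReal (μ ^ 2 * q₀ * Real.exp (-1) * (2 / Real.sqrt μ)) ≤ ∫⁻ x, ENNReal.ofReal (μ ^ 2 * q x * G 0 x ^ 2) := by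
  intro q K X₀ δ₀ hq hK hqpos hδ₀
  exact beam_package_uniform hq hK hqpos X₀ hδ₀

end Summit.FinalStateConjecture.FinalStateConjecture.Theorems.LagLaw
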